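import Literature.Computability.Complexity.SymbolPrograms
import Literature.Computability.Complexity.StackEventConsistency
import HarnessLib

/-!
# Runs of flat stack programs as per-register transcripts

Literature / complexity toolkit (serves the quasi-linear succinct Cook–Levin reduction behind
Williams' Fact 3.1, leaf `Williams2014_fact_3_1_skeleton`). A flat binary stack program
`P : AProg Bool ι` (`SymbolPrograms.lean`; every `TM2` machine has one,
`TM2Flat.exists_aprogFin_of_outputsWithin`) steps deterministically on a configuration
`⟨pc, regs⟩`. Its run is equally described by a *transcript*: the sequence of program
counters `pc s` together with the CLAIMED popped symbols `o s`; from these alone one reads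
off, for every register `k`, the stack event `regEv P k (pc s) (o s)` of `StackEvents.Ev`
(`StackEventConsistency.lean`). This file proves the two directions of the correspondence
one step at a time, which is how the local constraints of the tableau see a computation
(Cook 1971; the "guess the transcript, check each store separately" form is the one used by
quasi-linear Cook–Levin theorems, Fortnow–Lipton–van Melkebeek–Viglas 2005, §3.1):

* `regEv P k q o` — the event of register `k` when the instruction at `q` is executed with
  popped claim `o`; `ControlStep P q o q'` — the program-counter rule;
* `step_eq_of_transcript` (soundness of one step) — if the stores follow the events
  (`R' k = upd (regEv …) (R k)`), the claims hold on `R` (a `popNone` finds `[]`, a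
  `popSome b` finds `b` on top) and the control rule holds, then `P.step ⟨q, R⟩ = ⟨q', R'⟩`;
* `transcript_of_step` (completeness of one step) — conversely, with the popped claim READ OFF
  the configuration (`popped P c`), the genuine step obeys the control rule, the stores follow
  the events and the claims hold;
* `iterate_eq_of_transcript` — the interval version of soundness.

## References

* S. A. Cook, *The complexity of theorem-proving procedures*, STOC 1971, Thm. 1 [Cook1971].
* L. Fortnow, R. Lipton, D. van Melkebeek, A. Viglas, *Time-space lower bounds for
  satisfiability*, J. ACM 52 (2005) 835–865, §3.1 [FortnowEtAl2005].
-/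

namespace Literature.Computability.Complexity

namespace FlatRun

open StackEvents

variable {ι : Type} [DecidableEq ι]

/-- The event of register `k` when the instruction at address `q` of `P` is executed and the
popped claim is `o`. [cite: FortnowEtAl2005, §3.1] -/
def regEv (P : AProg Bool ι) (k : ι) (q : ℕ) (o : Option Bool) : Ev :=
  match P[q]? with
  | some (.push k' a) => if k' = k then .push a else .nop
  | some (.pop k' _) => if k' = k then (match o with | none => .popNone | some a => .popSome a)
      else .nop
  | _ => .nop

/-- The program-counter rule of one step from address `q` with popped claim `o` to `q'`.
[cite: Cook1971, Thm. 1] -/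
def ControlStep (P : AProg Bool ι) (q : ℕ) (o : Option Bool) (q' : ℕ) : Prop :=
  match P[q]? with
  | none => q' = q
  | some (.push _ _) => q' = q + 1
  | some (.goto j) => q' = j
  | some (.pop _ j) => q' = j o

/-- The popped claim read off a configuration: the top of the popped register (if the current
instruction is a pop), `none` otherwise. [folklore] -/
def popped (P : AProg Bool ι) (c : ACfg Bool ι) : Option Bool :=
  match P[c.pc]? with
  | some (.pop k _) => (c.regs k).head?
  | _ => none

/-- **Soundness of one step**: stores following the register events, true claims and the
control rule reproduce the deterministic step. [cite: Cook1971, Thm. 1] -/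
theorem step_eq_of_transcript (P : AProg Bool ι) {q q' : ℕ} {o : Option Bool}
    {R R' : AStore Bool ι} (hfollow : ∀ k, R' k = upd (regEv P k q o) (R k))
    (hnone : ∀ k, regEv P k q o = .popNone → R k = [])
    (hsome : ∀ k b, regEv P k q o = .popSome b → (R k).head? = some b)
    (hctrl : ControlStep P q o q') : P.step ⟨q, R⟩ = ⟨q', R'⟩ := by
  unfold ControlStep at hctrl
  rcases hP : P[q]? with _ | ⟨k, a⟩ | ⟨k, j⟩ | ⟨j⟩ <;> rw [hP] at hctrl <;> simp only at hctrl
  · subst hctrl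
    rw [P.step_of_le (List.getElem?_eq_none_iff.1 hP)]
    congr 1; funext k
    have hf := hfollow k; simp only [regEv, hP] at hf
    rw [hf]; rfl
  · subst hctrl
    have hstep : P.step ⟨q, R⟩ = ⟨q + 1, Function.update R k (a :: R k)⟩ := by
      rw [P.step_of_getElem? hP]
    rw [hstep]
    congr 1; funext k'
    have hf := hfollow k'; simp only [regEv, hP] at hf
    rw [hf]
    by_cases hk : k = k'
    · subst hk; simp [upd]
    · rw [if_neg hk, Function.update_of_ne (Ne.symm hk)]; rfl
  · subst hctrl
    cases ho : o with
    | none =>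
      have hevk : regEv P k q none = .popNone := by simp only [regEv, hP, if_true]
      have hRk : R k = [] := hnone k (by rw [ho, hevk])
      have hstep : P.step ⟨q, R⟩ = ⟨j none, R⟩ := by
        rw [P.step_of_getElem? hP]; simp only [hRk]
      rw [hstep]
      congr 1; funext k'
      have hf := hfollow k'; simp only [regEv, hP, ho] at hf
      rw [hf]
      by_cases hk : k = k'
      · subst hk; rw [if_pos rfl]; rfl
      · rw [if_neg hk]; rfl
    | some a =>
      have hevk : regEv P k q (some a) = .popSome a := by simp only [regEv, hP, if_true]
      have hhd : (R k).head? = some a := hsome k a (by rw [ho, hevk])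
      obtain ⟨w, hw⟩ : ∃ w, R k = a :: w := by
        cases hq : R k with
        | nil => rw [hq] at hhd; simp at hhd
        | cons a' w => rw [hq] at hhd; simp at hhd; subst hhd; exact ⟨w, rfl⟩
      have hstep : P.step ⟨q, R⟩ = ⟨j (some a), Function.update R k w⟩ := by
        rw [P.step_of_getElem? hP]; simp only [hw]
      rw [hstep]
      congr 1; funext k'
      have hf := hfollow k'; simp only [regEv, hP, ho] at hf
      rw [hf]
      by_cases hk : k = k'
      · subst hk; simp [upd, hw]
      · rw [if_neg hk, Function.update_of_ne (Ne.symm hk)]; rfl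
  · rw [hctrl]
    have hstep : P.step ⟨q, R⟩ = ⟨j, R⟩ := by rw [P.step_of_getElem? hP]
    rw [hstep]
    congr 1; funext k
    have hf := hfollow k; simp only [regEv, hP] at hf
    rw [hf]; rfl

/-- **Completeness of one step**: along the genuine step, with the popped claim read off the
configuration, the control rule holds, every register follows its event, and the claims are
true. [cite: Cook1971, Thm. 1] -/
theorem transcript_of_step (P : AProg Bool ι) (c : ACfg Bool ι) :
    ControlStep P c.pc (popped P c) (P.step c).pc ∧
    (∀ k, (P.step c).regs k = upd (regEv P k c.pc (popped P c)) (c.regs k)) ∧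
    (∀ k, regEv P k c.pc (popped P c) = .popNone → c.regs k = []) ∧
    (∀ k b, regEv P k c.pc (popped P c) = .popSome b → (c.regs k).head? = some b) := by
  obtain ⟨q, R⟩ := c
  rcases hP : P[q]? with _ | ⟨k, a⟩ | ⟨k, j⟩ | ⟨j⟩
  · have hstep : P.step ⟨q, R⟩ = ⟨q, R⟩ := P.step_of_le (List.getElem?_eq_none_iff.1 hP)
    have hev : ∀ k, regEv P k q (popped P ⟨q, R⟩) = .nop := fun k => by simp only [regEv, hP]
    refine ⟨?_, fun k => ?_, fun k h => ?_, fun k b h => ?_⟩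
    · show ControlStep P q _ (P.step ⟨q, R⟩).pc
      rw [hstep]; simp only [ControlStep, hP]
    · show (P.step ⟨q, R⟩).regs k = upd (regEv P k q _) (R k)
      rw [hstep, hev]; rfl
    · exact absurd ((hev k).symm.trans h) (by decide)
    · exact absurd ((hev k).symm.trans h) (by simp)
  · have hstep : P.step ⟨q, R⟩ = ⟨q + 1, Function.update R k (a :: R k)⟩ := by
      rw [P.step_of_getElem? hP]
    have hpop : popped P ⟨q, R⟩ = none := by simp only [popped, hP]
    have hev : ∀ k', regEv P k' q none = if k = k' then .push a else .nop := fun k' => by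
      simp only [regEv, hP]
    refine ⟨?_, fun k' => ?_, fun k' h => ?_, fun k' b h => ?_⟩
    · show ControlStep P q _ (P.step ⟨q, R⟩).pc
      rw [hstep, hpop]; simp only [ControlStep, hP]
    · show (P.step ⟨q, R⟩).regs k' = upd (regEv P k' q _) (R k')
      rw [hstep, hpop, hev]
      by_cases hk : k = k'
      · subst hk; simp [upd]
      · rw [if_neg hk]; simp only []; rw [Function.update_of_ne (Ne.symm hk)]; rfl
    · change regEv P k' q (popped P ⟨q, R⟩) = _ at h
      rw [hpop, hev] at h; by_cases hk : k = k' <;> simp [hk] at h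
    · change regEv P k' q (popped P ⟨q, R⟩) = _ at h
      rw [hpop, hev] at h; by_cases hk : k = k' <;> simp [hk] at h
  · cases hR : R k with
    | nil =>
      have hstep : P.step ⟨q, R⟩ = ⟨j none, R⟩ := by
        rw [P.step_of_getElem? hP]; simp only [hR]
      have hpop : popped P ⟨q, R⟩ = none := by simp only [popped, hP, hR]; rfl
      have hev : ∀ k', regEv P k' q none = if k = k' then .popNone else .nop := fun k' => by
        simp only [regEv, hP]
      refine ⟨?_, fun k' => ?_, fun k' h => ?_, fun k' b h => ?_⟩
      · show ControlStep P q _ (P.step ⟨q, R⟩).pc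
        rw [hstep, hpop]; simp only [ControlStep, hP]
      · show (P.step ⟨q, R⟩).regs k' = upd (regEv P k' q _) (R k')
        rw [hstep, hpop, hev]
        by_cases hk : k = k'
        · subst hk; rw [if_pos rfl]; rfl
        · rw [if_neg hk]; rfl
      · change R k' = []
        change regEv P k' q (popped P ⟨q, R⟩) = _ at h
        rw [hpop, hev] at h
        by_cases hk : k = k'
        · subst hk; exact hR
        · simp [hk] at h
      · change regEv P k' q (popped P ⟨q, R⟩) = _ at h
        rw [hpop, hev] at h; by_cases hk : k = k' <;> simp [hk] at h
    | cons a w =>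
      have hstep : P.step ⟨q, R⟩ = ⟨j (some a), Function.update R k w⟩ := by
        rw [P.step_of_getElem? hP]; simp only [hR]
      have hpop : popped P ⟨q, R⟩ = some a := by simp only [popped, hP, hR]; rfl
      have hev : ∀ k', regEv P k' q (some a) = if k = k' then .popSome a else .nop := fun k' => by
        simp only [regEv, hP]
      refine ⟨?_, fun k' => ?_, fun k' h => ?_, fun k' b h => ?_⟩
      · show ControlStep P q _ (P.step ⟨q, R⟩).pc
        rw [hstep, hpop]; simp only [ControlStep, hP]
      · show (P.step ⟨q, R⟩).regs k' = upd (regEv P k' q _) (R k')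
        rw [hstep, hpop, hev]
        by_cases hk : k = k'
        · subst hk; simp [upd, hR]
        · rw [if_neg hk]; simp only []; rw [Function.update_of_ne (Ne.symm hk)]; rfl
      · change regEv P k' q (popped P ⟨q, R⟩) = _ at h
        rw [hpop, hev] at h; by_cases hk : k = k' <;> simp [hk] at h
      · change (R k').head? = some b
        change regEv P k' q (popped P ⟨q, R⟩) = _ at h
        rw [hpop, hev] at h
        by_cases hk : k = k'
        · subst hk; simp at h; subst h; rw [hR]; rfl
        · simp [hk] at h
  · have hstep : P.step ⟨q, R⟩ = ⟨j, R⟩ := by rw [P.step_of_getElem? hP]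
    have hev : ∀ k, regEv P k q (popped P ⟨q, R⟩) = .nop := fun k => by simp only [regEv, hP]
    refine ⟨?_, fun k => ?_, fun k h => ?_, fun k b h => ?_⟩
    · show ControlStep P q _ (P.step ⟨q, R⟩).pc
      rw [hstep]; simp only [ControlStep, hP]
    · show (P.step ⟨q, R⟩).regs k = upd (regEv P k q _) (R k)
      rw [hstep, hev]; rfl
    · exact absurd ((hev k).symm.trans h) (by decide)
    · exact absurd ((hev k).symm.trans h) (by simp)

/-- **Soundness over an interval**: if for `T` consecutive steps from time `s₀` the stores
follow the events of the transcript `(pc, o)`, the claims hold and the control rule holds,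
then the configurations `⟨pc s, R s⟩` are the iterates of `P.step`. [cite: Cook1971, Thm. 1] -/
theorem iterate_eq_of_transcript (P : AProg Bool ι) (pc : ℕ → ℕ) (o : ℕ → Option Bool)
    (R : ℕ → AStore Bool ι) (s₀ T : ℕ)
    (hfollow : ∀ s, s₀ ≤ s → s < s₀ + T → ∀ k, R (s + 1) k = upd (regEv P k (pc s) (o s)) (R s k))
    (hnone : ∀ s, s₀ ≤ s → s < s₀ + T → ∀ k, regEv P k (pc s) (o s) = .popNone → R s k = [])
    (hsome : ∀ s, s₀ ≤ s → s < s₀ + T → ∀ k b, regEv P k (pc s) (o s) = .popSome b →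
      (R s k).head? = some b)
    (hctrl : ∀ s, s₀ ≤ s → s < s₀ + T → ControlStep P (pc s) (o s) (pc (s + 1))) :
    ∀ u ≤ T, (P.step^[u]) ⟨pc s₀, R s₀⟩ = ⟨pc (s₀ + u), R (s₀ + u)⟩ := by
  intro u
  induction u with
  | zero => intro _; rfl
  | succ u ih =>
    intro hu
    have hu' : u < T := Nat.lt_of_succ_le hu
    rw [Function.iterate_succ_apply', ih hu'.le]
    have hs1 : s₀ ≤ s₀ + u := Nat.le_add_right _ _
    have hs2 : s₀ + u < s₀ + T := Nat.add_lt_add_left hu' _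
    rw [step_eq_of_transcript P (hfollow _ hs1 hs2) (hnone _ hs1 hs2) (hsome _ hs1 hs2)
      (hctrl _ hs1 hs2)]
    rfl

end FlatRun

end Literature.Computability.Complexity
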